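import Mathlib

/-!
# `OrigamiRung` — negative-side support: mutation shadows for line `pair-rigidity-endgame`

Crux `SymplecticOrigami.OrigamiRung` (item stmt-SmoothPoincare4-7843), drefute seat
(refuter-drefute-stmt-SmoothPoincare4-7843-0, 2026-08-16), skeleton `Lines/pair-rigidity-endgame.lean`
(lead reshape r1, sha 058809ab…, stubs `stub_sides`, `stub_pinch`, `stub_genusFormula`,
`stub_sphereOfGenusZero`, `stub_ballPiece`).  All five stubs SURVIVED the cheap arsenal (paper
re-derivation clause by clause, typed-fidelity audit of `MForm.inChart` / `IsSmoothForm` /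
`IsClosedForm` / `Manifold.IsSmoothEmbedding` / `singularHomologyZ`, degenerate instances, hypothesis
mutation).  This file records, as checked arithmetic, the two mutation findings that carry
information for the prover — which hypotheses the proofs of `stub_genusFormula` and `stub_pinch`
MUST consume — in the style of `Negative.GenusTable` (`bettiPinch`, `door_is_solution`):

* `genusFormula_signature_branches`: the arithmetic of `stub_genusFormula` run with the sign
  `σ = h² ∈ {+1, −1}` of the rank-one intersection form left FREE (everything else as in the stub's
  proof plan: meridian dead `m = 1`, `S·S = σ`, adjunction `c₁·S = χ(S) + S·S`, `c₁² = σ c²`,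
  `c₁² = 2χ + 3σ` with `χ = 3 − 2b₁`) has exactly two branches: `σ = +1, b₁ = 3g − g²` (the stub's
  conclusion) and `σ = −1, b₁ = g² − g + 1`.
* `genusFormula_negBranch_ne`: the `σ = −1` branch NEVER satisfies the stub's conclusion
  `b₁ + g² = 3g`.  It is realised on paper by the blown-up Hopf surface
  `N = Bl_pt(S¹ × S³) ≅ S¹ × S³ # ℂP²bar ⊃ E` (exceptional curve, `g = 0`, `b₁ = b₂ = 1`,
  `σ = −1`, `H₁(N ∖ E) ≅ H₁(N) ≅ ℤ` free of rank `k = 1`) with a HERMITIAN form `s = g(J·,·)`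
  (smooth, non-degenerate on `N` and on the holomorphic curve `E`, NOT closed): every hypothesis of
  `stub_genusFormula` except `IsClosedForm s` holds and `k + g² = 1 ≠ 0 = 3g`
  (`genusFormula_false_without_closed_tuple`).  So `IsClosedForm` is load-bearing in
  `stub_genusFormula`, and it enters at exactly one place: `[s]² > 0 ⇒ σ = +1`.
* `pinch_chiCount_without_b2_pos`: the χ-count of `stub_pinch` without `b₂(N i) ≥ 1` on ONE side
  admits `(g, b₁(N₀), b₁(N₁), b₂(N₀), b₂(N₁)) = (0, 0, 0, 2, 0)`, realised on paper by the fold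
  `S⁴ = S² × D² ∪_{S² × S¹} D³ × S¹` (pieces `(S² × S², S² × pt)` — symplectic — and
  `(S⁴, unknotted S²)` — not even almost complex; radial blow-downs of corank one, Euler number
  `e = 0`): the symplectic clauses of EACH piece are load-bearing in `stub_pinch` (they give
  `b₂(N i) ≥ 1` via `[s i]² ≠ 0`, i.e. closed AND non-degenerate), and the conclusion
  `finrank H₂(N 1) = 1` fails there.

No statement of the route is asserted or denied here; these are support lemmas for the prover of
stmt-SmoothPoincare4-7843 (briefing: crux evidence `stubs-survived`, Negative-notes
`drefute-pair-rigidity-endgame.md`).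
-/

-- the prescribed namespace `Summit.<P>.<Sub>.…` duplicates `SmoothPoincare4` (P = Sub)
set_option linter.dupNamespace false

namespace Summit.SmoothPoincare4.SmoothPoincare4.Theorems.OrigamiRung.Negative

/-- **Genus-formula arithmetic with the sign of the form left free.**  Per piece: `b₂ = 1`, form
`⟨σ⟩` on `H₂/Tors = ℤh` (`σ = h² = ±1`), symplectic surface `S` of genus `g` with free
`H₁(N ∖ S)` (so `[S] = h` up to sign and torsion, `S·S = σ`), `c = ⟨c₁, S⟩`; adjunction
`c = (2 − 2g) + S·S`, `c₁ = c·h* + Tors` with `(h*)² = σ`, and `c₁² = 2χ + 3σ`, `χ = 3 − 2b₁`.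
Output: `σ = +1 ∧ b₁ + g² = 3g` (the conclusion of `stub_genusFormula`) or
`σ = −1 ∧ b₁ = g² − g + 1`. [folklore] -/
theorem genusFormula_signature_branches (g b₁ : ℕ) (σ c : ℤ) (hσ : σ = 1 ∨ σ = -1)
    (hadj : c = 2 - 2 * (g : ℤ) + σ) (hsq : σ * c ^ 2 = 2 * (3 - 2 * (b₁ : ℤ)) + 3 * σ) :
    (σ = 1 ∧ (b₁ : ℤ) + g * g = 3 * g) ∨ (σ = -1 ∧ (b₁ : ℤ) = g * g - g + 1) := by
  rcases hσ with rfl | rfl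
  · left
    refine ⟨rfl, ?_⟩
    subst hadj
    have h4 : 4 * ((b₁ : ℤ) + g * g - 3 * g) = 0 := by linear_combination hsq
    linarith
  · right
    refine ⟨rfl, ?_⟩
    subst hadj
    have h4 : 4 * ((b₁ : ℤ) - (g * g - g + 1)) = 0 := by linear_combination hsq
    linarith

/-- **The negative-definite branch never meets the stub's conclusion**: `b₁ = g² − g + 1` and
`b₁ + g² = 3g` have no common solution in `ℕ` (`2g² − 4g + 1 = 0` has no integer root).  Hence a
proof of `stub_genusFormula` must establish `σ = +1`, which is where `IsClosedForm s` enters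
(`[s]² > 0`). [folklore] -/
theorem genusFormula_negBranch_ne (g b₁ : ℕ) (hb : (b₁ : ℤ) = g * g - g + 1) :
    b₁ + g * g ≠ 3 * g := by
  intro h
  have h' : (b₁ : ℤ) + g * g = 3 * g := by exact_mod_cast h
  rcases le_or_gt g 1 with hg | hg
  · interval_cases g <;> norm_num at hb h' <;> omega
  · have hg2 : (2 : ℤ) ≤ g := by exact_mod_cast hg
    nlinarith [mul_nonneg (sub_nonneg.mpr hg2) (by positivity : (0 : ℤ) ≤ g)]

/-- **Witness tuple for `stub_genusFormula` without `IsClosedForm`** (paper realisation: the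
blown-up Hopf surface `Bl_pt(S¹ × S³) ⊃ E` with a Hermitian, non-closed, non-degenerate form):
`(g, b₁, b₂, σ, c, k) = (0, 1, 1, −1, 1, 1)` satisfies the χ/σ bookkeeping (`χ = 3 − 2b₁ = 1`,
`c₁² = σc² = −1 = 2χ + 3σ`), adjunction (`c = 2 − 2g + σ`), the almost-complex parity
(`1 − b₁ + b⁺` even with `b⁺ = 0`), `k = b₁` (meridian dead), and VIOLATES `k + g² = 3g`.
[folklore] -/
theorem genusFormula_false_without_closed_tuple :
    let g : ℕ := 0; let b₁ : ℕ := 1; let b₂ : ℕ := 1; let σ : ℤ := -1; let c : ℤ := 1; let k : ℕ := 1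
    let χ : ℤ := 2 - 2 * b₁ + b₂; let bplus : ℕ := 0
    σ * c ^ 2 = 2 * χ + 3 * σ ∧ c = 2 - 2 * (g : ℤ) + σ ∧ (1 - (b₁ : ℤ) + bplus) % 2 = 0 ∧
      k = b₁ ∧ k + g * g ≠ 3 * g := by
  decide

/-- **χ-count of the pinch without `b₂ ≥ 1` on one side.**  The inputs of `Negative.bettiPinch`
minus `1 ≤ c₁` admit the tuple `(g, a₀, a₁, c₀, c₁) = (0, 0, 0, 2, 0)` (χ-identity and the
Mayer–Vietoris bound in its `e = 0` form `a₀ + a₁ ≤ 2g + 1`), on which the conclusion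
`c₀ = 1 ∧ c₁ = 1` of the pinch fails.  Paper realisation: `S⁴ = S² × D² ∪ D³ × S¹`, pieces
`N₀ = S² × S² ⊃ S² × pt` (symplectic, `b₂ = 2`) and `N₁ = S⁴ ⊃ S²` (no symplectic form, `b₂ = 0`),
both blow-downs radial of corank one, `e = 0`, `g = 0`.  So the symplectic clauses of BOTH pieces are
load-bearing in `stub_pinch`. [folklore] -/
theorem pinch_chiCount_without_b2_pos :
    ∃ g a₀ a₁ c₀ c₁ : ℕ, ((2 : ℤ) - 2 * a₀ + c₀) + (2 - 2 * a₁ + c₁) = 6 - 4 * g ∧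
      a₀ + a₁ ≤ 2 * g + 1 ∧ 1 ≤ c₀ ∧ ¬ (c₀ = 1 ∧ c₁ = 1) :=
  ⟨0, 0, 0, 2, 0, by norm_num⟩

end Summit.SmoothPoincare4.SmoothPoincare4.Theorems.OrigamiRung.Negative
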